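import Summits.BirchSwinnertonDyer.BirchSwinnertonDyer.Theses.UniversalToricDescent
import Summits.BirchSwinnertonDyer.BirchSwinnertonDyer.Theorems.UniversalToricDescentHessianTwinAtThree
import HarnessLib

/-!
# Route UniversalToricDescent — closer of the support item 23782 `GoodSSApZeroTwinSupplyOnTypeAtThree`
# (the `a₃ = 0` twin supply ON the Hessian type `v₃(c₄) = 4`, `v₃(c₆) ≥ 7`)

Prover bsd-wall-utd-p1 g8 (`--workitem stmt-BirchSwinnertonDyer-23782`; steward pss3x g0's one-liner of
2026-08-27T23:49Z). For a wild curve `W/ℚ` of class O6 at `3` on the `3`-adic type `v₃(c₄) = 4`,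
`v₃(c₆) ≥ 7`, THE HESSIAN IS THE `a₃ = 0` TWIN: Fisher's Hesse-pencil member `D(0:1)` is `3`-congruent to
`W` (Fisher 2012 Thm. 13.2, tree-proved) and has good supersingular reduction at `3` with `a₃ = 0` on the
whole type — utd-p2's `UniversalToricDescentHessianTwin.hasGoodSSApZeroTwinAtThree_of_padicValRat`
(p583681), restated at the route decl. THEOREM ONLY; BSD is not advanced by this file.
References: [Fisher2012Hessian] Thm. 13.2; [RubinSilverberg1995] §1.
-/

set_option autoImplicit false
-- `…BirchSwinnertonDyer.BirchSwinnertonDyer.Theorems…` is the problem's mandated namespace (D-0017).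
set_option linter.dupNamespace false

namespace Summit.BirchSwinnertonDyer.BirchSwinnertonDyer.Theorems

/-- **Item 23782 holds**: on the Hessian type `v₃(c₄) = 4`, `v₃(c₆) ≥ 7` every class-O6 curve has a
`3`-congruent good-supersingular twin with `a₃ = 0` (its Hessian; utd-p2 g6/g7, p583681).
[cite: Fisher2012Hessian, Thm. 13.2] -/
theorem goodSSApZeroTwinSupplyOnTypeAtThree_proof :
    Summit.BirchSwinnertonDyer.BirchSwinnertonDyer.Theses.UniversalToricDescent.GoodSSApZeroTwinSupplyOnTypeAtThree :=
  fun W _ _ _ h4 h7 ↦ UniversalToricDescentHessianTwin.hasGoodSSApZeroTwinAtThree_of_padicValRat W h4 h7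

end Summit.BirchSwinnertonDyer.BirchSwinnertonDyer.Theorems
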